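import Mathlib.RingTheory.MvPolynomial.Basic
import Mathlib.Algebra.MvPolynomial.CommRing
import Mathlib.RingTheory.Ideal.Maps
import Mathlib.RingTheory.Ideal.IsPrimary
import Mathlib.RingTheory.Ideal.Maximal
import Mathlib.RingTheory.Ideal.Operations
import HarnessLib

/-!
# Fedder's test at a point: unit factors and free coordinates (toric chart theorem, reductions B1/B2)
(crux `FInjectiveMacaulayfication`, hole #4 class CN / hole #3 strata; toward idea-2's `toricChart_fedder`)

[OURS · L1 W4.5a] Support file for crux stmt-ResolutionOfSingularities-15315
(`Summit.ResolutionOfSingularities.ResolutionOfSingularities.Theses.FrobeniusLadder.FInjectiveMacaulayfication`, route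
`FrobeniusLadder`, skeleton v11 `86e9127b5c98b8e6`).  Seat table v5 (stub-1 (b)): the Cartier–Newton CHART THEOREM in Fedder form
(idea-2 `toricChart_fedder`, Sketch-L1-idea-2.lean v2) says that the strict transform `g` of `f` under a unimodular monomial chart
passes Fedder's non-membership test `g^(p-1) ∉ ((Yᵢ - aᵢ)^p : i)` at a point `a` with vanishing exceptional coordinates `S`, provided the
face of `f` cut out by `w = Σ_{i∈S} vᵢ` is F-pure on the torus.  Its proof has four parts (STATUS 2026-08-27, stub-1): (B1) restriction
to the orbit closure `{Y_S = 0}` / independence of the `S`-coordinates of the point, (B2) removal of unit (monomial) factors at the point,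
(B3) transport along the monomial change of torus coordinates (an iso of LOCAL rings — the non-routine part), (B4) the chart identity
`g mod (Y_S) = θ(in_w f) / Y^d`.  This file lands the point-local reductions (B1) and (B2), for an arbitrary field `K` and finitely
many variables `Fin n`, with the Frobenius power of the maximal ideal at `c` written `((Yᵢ - cᵢ)^p : i)`:

* §1 `subst_frobeniusSpan_le` — the substitution `Yᵢ ↦ cᵢ (i ∈ S)`, `Yᵢ ↦ Yᵢ (i ∉ S)` maps `((Yᵢ - cᵢ)^p : i)` into itself (indeed into
  the part `i ∉ S`); `pow_mem_frobeniusSpan_of_subst` — hence for `h` FIXED by that substitution (an `S`-free polynomial), membership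
  `h^r ∈ ((Yᵢ - cᵢ)^p)` does not depend on the coordinates `cᵢ, i ∈ S`; `faceFedder_lift_finset` — and for any `g`,
  `g^r ∈ ((Yᵢ - cᵢ)^p : i) ⇒ ḡ^r ∈ ((Yᵢ - cᵢ)^p : i)` for `ḡ = g(c_S, Y_{Sᶜ})` (Finset-indexed form of `FaceFedderLift.faceFedder_lift`);
* §2 `isPrimary_frobeniusSpan`, `mul_mem_frobeniusSpan_iff` — `((Yᵢ - cᵢ)^p : i)` is primary to the maximal ideal `(Yᵢ - cᵢ : i)`, so a
  factor `u` with `u ∉ (Yᵢ - cᵢ : i)` (e.g. a monomial in coordinates non-zero at `c`) can be cancelled: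
  `u * x ∈ ((Yᵢ - cᵢ)^p) ↔ x ∈ ((Yᵢ - cᵢ)^p)`; `mul_pow_mem_frobeniusSpan_iff` — `(u*h)^r ∈ … ↔ h^r ∈ …`.

Folklore; no definition is declared; AI-written, weaker than expert review; no statement of [claim: Hironaka2017] is used.
[cite: Fedder1983, Prop. 1.7 (the test being manipulated)]
-/

-- single-problem summit: the doubled namespace component is forced
set_option linter.dupNamespace false

noncomputable section

namespace Summit.ResolutionOfSingularities.ResolutionOfSingularities.Theorems.FInjectiveMacaulayfication.FedderPointReductions

open MvPolynomial

variable {K : Type} [Field K] {n : ℕ}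

/-! ## §1 Substituting values for a set `S` of coordinates -/

/-- The substitution `Yᵢ ↦ cᵢ` for `i ∈ S`, `Yᵢ ↦ Yᵢ` otherwise, maps the ideal `((Yᵢ - cᵢ)^p : i)` into itself (the generators with
`i ∈ S` go to `0`, the others are fixed), for `p ≠ 0`. [folklore] -/
theorem subst_frobeniusSpan_le (p : ℕ) (hp : p ≠ 0) (S : Finset (Fin n)) (c : Fin n → K) :
    (Ideal.span (Set.range fun i : Fin n => (X i - C (c i)) ^ p)).map
      (aeval (fun i : Fin n => if i ∈ S then C (c i) else (X i : MvPolynomial (Fin n) K))) ≤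
      Ideal.span (Set.range fun i : Fin n => (X i - C (c i)) ^ p) := by
  rw [Ideal.map_span]
  refine Ideal.span_le.mpr ?_
  rintro _ ⟨_, ⟨i, rfl⟩, rfl⟩
  by_cases hi : i ∈ S
  · have e : aeval (fun i : Fin n => if i ∈ S then C (c i) else (X i : MvPolynomial (Fin n) K))
        ((X i - C (c i)) ^ p) = 0 := by
      rw [map_pow, map_sub, aeval_X, aeval_C, if_pos hi, algebraMap_eq, sub_self, zero_pow hp]
    rw [e]; exact Ideal.zero_mem _
  · have e : aeval (fun i : Fin n => if i ∈ S then C (c i) else (X i : MvPolynomial (Fin n) K))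
        ((X i - C (c i)) ^ p) = (X i - C (c i)) ^ p := by
      rw [map_pow, map_sub, aeval_X, aeval_C, if_neg hi, algebraMap_eq]
    rw [e]; exact Ideal.subset_span ⟨i, rfl⟩

/-- **Finset face lemma** (B1): for any `g`, if `g^r ∈ ((Yᵢ - cᵢ)^p : i)` then `ḡ^r ∈ ((Yᵢ - cᵢ)^p : i)` where `ḡ = g(c_S, Y_{Sᶜ})` is
the restriction to the orbit closure through `c` — contrapositively, Fedder's non-membership test for `ḡ` at `c` implies it for `g`
(`FaceFedderLift.faceFedder_lift` is the case `c_S = 0` in `Sum`-indexed coordinates). [folklore] -/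
theorem faceFedder_lift_finset (p : ℕ) (hp : p ≠ 0) (S : Finset (Fin n)) (c : Fin n → K)
    (g : MvPolynomial (Fin n) K) (r : ℕ)
    (h : (aeval (fun i : Fin n => if i ∈ S then C (c i) else (X i : MvPolynomial (Fin n) K)) g) ^ r ∉
      Ideal.span (Set.range fun i : Fin n => (X i - C (c i)) ^ p)) :
    g ^ r ∉ Ideal.span (Set.range fun i : Fin n => (X i - C (c i)) ^ p) := by
  intro hmem
  apply h
  rw [← map_pow]
  exact subst_frobeniusSpan_le p hp S c (Ideal.mem_map_of_mem _ hmem)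

/-- **Free coordinates** (B1): if `h` is fixed by the substitution `Yᵢ ↦ cᵢ (i ∈ S)` — an `S`-free polynomial — then membership of `h^r` in
`((Yᵢ - c'ᵢ)^p : i)` for a point `c'` agreeing with `c` ON `S` implies membership in `((Yᵢ - c''ᵢ)^p : i)` for every point `c''` agreeing with
`c'` OFF `S`: the `S`-coordinates of the point are irrelevant. [folklore] -/
theorem pow_mem_frobeniusSpan_of_subst (p : ℕ) (hp : p ≠ 0) (S : Finset (Fin n)) (c c' c'' : Fin n → K)
    (hc : ∀ i ∈ S, c' i = c i) (hc'' : ∀ i, i ∉ S → c'' i = c' i)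
    (h : MvPolynomial (Fin n) K) (r : ℕ)
    (hfix : aeval (fun i : Fin n => if i ∈ S then C (c i) else (X i : MvPolynomial (Fin n) K)) h = h)
    (hmem : h ^ r ∈ Ideal.span (Set.range fun i : Fin n => (X i - C (c' i)) ^ p)) :
    h ^ r ∈ Ideal.span (Set.range fun i : Fin n => (X i - C (c'' i)) ^ p) := by
  -- apply the substitution: the `S`-generators die, the others are generators at `c''`
  have hc' : (fun i : Fin n => if i ∈ S then C (c i) else (X i : MvPolynomial (Fin n) K)) =
      fun i : Fin n => if i ∈ S then C (c' i) else (X i : MvPolynomial (Fin n) K) := by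
    funext i
    by_cases hi : i ∈ S
    · rw [if_pos hi, if_pos hi, hc i hi]
    · rw [if_neg hi, if_neg hi]
  have h1 := subst_frobeniusSpan_le p hp S c' (Ideal.mem_map_of_mem
    (aeval (fun i : Fin n => if i ∈ S then C (c' i) else (X i : MvPolynomial (Fin n) K))) hmem)
  rw [map_pow, ← hc', hfix] at h1
  -- the image actually lies in the span of the generators with `i ∉ S`, which are generators at `c''` too
  have h2 : (Ideal.span (Set.range fun i : Fin n => (X i - C (c' i)) ^ p)).map
      (aeval (fun i : Fin n => if i ∈ S then C (c' i) else (X i : MvPolynomial (Fin n) K))) ≤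
      Ideal.span (Set.range fun i : Fin n => (X i - C (c'' i)) ^ p) := by
    rw [Ideal.map_span]
    refine Ideal.span_le.mpr ?_
    rintro _ ⟨_, ⟨i, rfl⟩, rfl⟩
    by_cases hi : i ∈ S
    · have e : aeval (fun i : Fin n => if i ∈ S then C (c' i) else (X i : MvPolynomial (Fin n) K))
          ((X i - C (c' i)) ^ p) = 0 := by
        rw [map_pow, map_sub, aeval_X, aeval_C, if_pos hi, algebraMap_eq, sub_self, zero_pow hp]
      rw [e]; exact Ideal.zero_mem _
    · have e : aeval (fun i : Fin n => if i ∈ S then C (c' i) else (X i : MvPolynomial (Fin n) K))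
          ((X i - C (c' i)) ^ p) = (X i - C (c'' i)) ^ p := by
        rw [map_pow, map_sub, aeval_X, aeval_C, if_neg hi, algebraMap_eq, hc'' i hi]
      rw [e]; exact Ideal.subset_span ⟨i, rfl⟩
  have h3 := h2 (Ideal.mem_map_of_mem
    (aeval (fun i : Fin n => if i ∈ S then C (c' i) else (X i : MvPolynomial (Fin n) K))) hmem)
  rwa [map_pow, ← hc', hfix] at h3

/-! ## §2 Cancelling unit factors at the point -/

/-- The ideal `((Yᵢ - cᵢ)^p : i)` is primary, with radical the maximal ideal `(Yᵢ - cᵢ : i)` (`p ≠ 0`). [folklore] -/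
-- adapted from the primary-ideal step of `FedderAtMaximalIdeal.algebraMap_pow_mem_frobeniusPower_maximalIdeal_iff`
theorem isPrimary_frobeniusSpan (p : ℕ) (hp : p ≠ 0) (c : Fin n → K)
    (P : Ideal (MvPolynomial (Fin n) K)) [P.IsMaximal] (hP : P = Ideal.span (Set.range fun i : Fin n => X i - C (c i))) :
    (Ideal.span (Set.range fun i : Fin n => (X i - C (c i)) ^ p)).IsPrimary ∧
      (Ideal.span (Set.range fun i : Fin n => (X i - C (c i)) ^ p)).radical = P := by
  set Q : Ideal (MvPolynomial (Fin n) K) := Ideal.span (Set.range fun i : Fin n => (X i - C (c i)) ^ p)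
  have hQP : Q ≤ P := by
    rw [hP]
    refine Ideal.span_le.mpr ?_
    rintro _ ⟨i, rfl⟩
    exact Ideal.pow_mem_of_mem _
      (Ideal.subset_span (Set.mem_range_self (f := fun i : Fin n => X i - C (c i)) i)) p (Nat.pos_of_ne_zero hp)
  have hrad : Q.radical = P := by
    refine le_antisymm ((Ideal.IsMaximal.isPrime' P).radical_le_iff.mpr hQP) ?_
    rw [hP]
    refine Ideal.span_le.mpr ?_
    rintro _ ⟨i, rfl⟩
    exact Ideal.mem_radical_iff.mpr
      ⟨p, Ideal.subset_span (Set.mem_range_self (f := fun i : Fin n => (X i - C (c i)) ^ p) i)⟩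
  exact ⟨Ideal.isPrimary_of_isMaximal_radical (hrad ▸ inferInstance), hrad⟩

/-- **Unit factors cancel in Fedder's test** (B2): if `u ∉ (Yᵢ - cᵢ : i)` (i.e. `u(c) ≠ 0`), then `u * x ∈ ((Yᵢ - cᵢ)^p : i)` iff
`x ∈ ((Yᵢ - cᵢ)^p : i)`. [folklore] -/
theorem mul_mem_frobeniusSpan_iff (p : ℕ) (hp : p ≠ 0) (c : Fin n → K)
    (P : Ideal (MvPolynomial (Fin n) K)) [P.IsMaximal] (hP : P = Ideal.span (Set.range fun i : Fin n => X i - C (c i)))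
    (u x : MvPolynomial (Fin n) K) (hu : u ∉ P) :
    u * x ∈ Ideal.span (Set.range fun i : Fin n => (X i - C (c i)) ^ p) ↔
      x ∈ Ideal.span (Set.range fun i : Fin n => (X i - C (c i)) ^ p) := by
  obtain ⟨hprim, hrad⟩ := isPrimary_frobeniusSpan p hp c P hP
  constructor
  · intro h
    rw [mul_comm] at h
    rcases (Ideal.isPrimary_iff.mp hprim).2 h with h1 | h1
    · exact h1
    · exact absurd (hrad ▸ h1) hu
  · exact fun h => Ideal.mul_mem_left _ u h

/-- **Unit factors cancel in Fedder's test, power form** (B2): for `u ∉ (Yᵢ - cᵢ : i)` and any `r`,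
`(u * h)^r ∈ ((Yᵢ - cᵢ)^p : i) ↔ h^r ∈ ((Yᵢ - cᵢ)^p : i)` — so `FedderAt p (u * h) c ↔ FedderAt p h c` in idea-2's notation, e.g. for
`u = Y^d` a monomial in coordinates that do not vanish at `c`. [folklore] -/
theorem mul_pow_mem_frobeniusSpan_iff (p : ℕ) (hp : p ≠ 0) (c : Fin n → K)
    (P : Ideal (MvPolynomial (Fin n) K)) [P.IsMaximal] (hP : P = Ideal.span (Set.range fun i : Fin n => X i - C (c i)))
    (u h : MvPolynomial (Fin n) K) (hu : u ∉ P) (r : ℕ) :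
    (u * h) ^ r ∈ Ideal.span (Set.range fun i : Fin n => (X i - C (c i)) ^ p) ↔
      h ^ r ∈ Ideal.span (Set.range fun i : Fin n => (X i - C (c i)) ^ p) := by
  have hur : u ^ r ∉ P := fun h' => hu ((Ideal.IsMaximal.isPrime' P).mem_of_pow_mem r h')
  rw [mul_pow]
  exact mul_mem_frobeniusSpan_iff p hp c P hP (u ^ r) (h ^ r) hur

end Summit.ResolutionOfSingularities.ResolutionOfSingularities.Theorems.FInjectiveMacaulayfication.FedderPointReductions

end
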